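import Mathlib
import Summits.KontsevichZagierPeriods.Zeta5Search.PadicIrrationalityCriterion
import HarnessLib

/-!
# A `p`-adic irrationality MEASURE from two-sided integer linear forms

Cell `pub-zeta5`, family seat fam-catalan. HONEST FRAMING: systematic search; no irrationality claim unless
certified. GENERAL INFRASTRUCTURE (no statement about any specific constant): the measure half of the 2-adic
criterion of `families/catalan/TWOADIC.md` §2. If integers `a_n, b_n` satisfy, for `n ≥ n₀`,
`|a_n| + |b_n| ≤ e^{h n}`, `e^{−τ' n} ≤ ‖a_n ξ + b_n‖_p < e^{−τ n}` with `0 ≤ h < τ ≤ τ'`, then for every rational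
`r = u/v` (lowest terms, `H = max(|u|, v)`):  `‖ξ − r‖_p ≥ e^{−τ'(n₀+1)} · H^{−τ'/(τ−h)}`.
So the `p`-adic irrationality exponent of `ξ` is at most `τ'/(τ − h)`; the two-sided size hypothesis replaces the
usual non-vanishing-determinant argument (if `a_n r + b_n = 0` the form itself is `a_n(ξ − r)`).

Proof: with `n = max(n₀, ⌊log H/(τ−h)⌋ + 1)` and `D = a_n u + b_n v ∈ ℤ` one has `v·a_n·(ξ − r) = v·(a_nξ + b_n) − D`.
If `D = 0`, `‖ξ − r‖ ≥ ‖a_n(ξ−r)‖ = ‖a_nξ+b_n‖ ≥ e^{−τ'n}`. If `D ≠ 0`, `‖D‖_p ≥ 1/|D| ≥ e^{−hn}/H > e^{−τn} > ‖v(a_nξ+b_n)‖`,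
so by the ultrametric inequality `‖ξ − r‖ ≥ ‖v a_n (ξ−r)‖ = ‖D‖_p ≥ e^{−hn}/H`. Finally `n ≤ n₀ + 1 + log H/(τ−h)`
turns both bounds into the stated power of `H`.
-/

namespace Summit.KontsevichZagierPeriods.Zeta5Search.PadicIrrationality

open Real in
/-- **`p`-adic irrationality measure from two-sided small integer forms.** -/
theorem measure_of_two_sided_forms {p : ℕ} [hp : Fact p.Prime] (ξ : ℚ_[p]) (a b : ℕ → ℤ)
    {h τ τ' : ℝ} {n₀ : ℕ} (hh : 0 ≤ h) (hτ : h < τ) (hτ' : τ ≤ τ')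
    (hgrowth : ∀ n, n₀ ≤ n → ((a n).natAbs + (b n).natAbs : ℝ) ≤ exp (h * n))
    (hupper : ∀ n, n₀ ≤ n → ‖(a n : ℚ_[p]) * ξ + b n‖ < exp (-(τ * n)))
    (hlower : ∀ n, n₀ ≤ n → exp (-(τ' * n)) ≤ ‖(a n : ℚ_[p]) * ξ + b n‖) (r : ℚ) :
    exp (-(τ' * (n₀ + 1))) * (max (r.num.natAbs : ℝ) r.den) ^ (-(τ' / (τ - h)))
      ≤ ‖ξ - ((r : ℚ) : ℚ_[p])‖ := by
  -- notation: r = u / v, height H, scale L, index n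
  set u : ℤ := r.num with hu
  set v : ℕ := r.den with hv
  set H : ℝ := max (u.natAbs : ℝ) v with hHdef
  have hv1 : (1 : ℝ) ≤ v := by exact_mod_cast r.den_pos
  have hH1 : 1 ≤ H := hv1.trans (le_max_right _ _)
  have hHpos : 0 < H := by linarith
  have hlogH : 0 ≤ log H := log_nonneg hH1
  have hth : 0 < τ - h := by linarith
  set L : ℝ := log H / (τ - h) with hL
  have hL0 : 0 ≤ L := div_nonneg hlogH hth.le
  have hlogL : log H = (τ - h) * L := by rw [hL]; field_simp
  set n : ℕ := max n₀ (⌊L⌋₊ + 1) with hn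
  have hn0 : n₀ ≤ n := le_max_left _ _
  have hLn : L < n := by
    have h1 : L < ((⌊L⌋₊ + 1 : ℕ) : ℝ) := by push_cast; exact Nat.lt_floor_add_one L
    have h2 : ((⌊L⌋₊ + 1 : ℕ) : ℝ) ≤ n := by exact_mod_cast le_max_right _ _
    exact h1.trans_le h2
  have hnle : (n : ℝ) ≤ n₀ + 1 + L := by
    rcases le_total n₀ (⌊L⌋₊ + 1) with hc | hc
    · have e : n = ⌊L⌋₊ + 1 := max_eq_right hc
      have hf := Nat.floor_le hL0
      have : (0 : ℝ) ≤ n₀ := by positivity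
      rw [e]; push_cast; linarith
    · have e : n = n₀ := max_eq_left hc
      rw [e]; linarith
  -- the form φ and the integer D
  set φ : ℚ_[p] := (a n : ℚ_[p]) * ξ + b n with hφ
  set D : ℤ := a n * u + b n * v with hD
  have hvr : (v : ℚ_[p]) * ((r : ℚ) : ℚ_[p]) = (u : ℚ_[p]) := by
    have h1 : ((r.den : ℚ) * r : ℚ) = (r.num : ℚ) := Rat.den_mul_eq_num r
    rw [hu, hv]; exact_mod_cast h1
  have hident : (v : ℚ_[p]) * (a n : ℚ_[p]) * (ξ - r) = (v : ℚ_[p]) * φ - D := by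
    rw [hφ, hD]; push_cast
    linear_combination (-(a n : ℚ_[p])) * hvr
  have hnv : ‖(v : ℚ_[p])‖ ≤ 1 := by simpa using Padic.norm_int_le_one (p := p) (v : ℤ)
  have hna : ‖(a n : ℚ_[p])‖ ≤ 1 := Padic.norm_int_le_one (p := p) (a n)
  have ha_le : ‖(a n : ℚ_[p]) * (ξ - r)‖ ≤ ‖ξ - ((r : ℚ) : ℚ_[p])‖ := by
    rw [norm_mul]
    calc ‖(a n : ℚ_[p])‖ * ‖ξ - r‖ ≤ 1 * ‖ξ - r‖ := by gcongr
      _ = _ := one_mul _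
  have hva_le : ‖(v : ℚ_[p]) * (a n : ℚ_[p]) * (ξ - r)‖ ≤ ‖ξ - ((r : ℚ) : ℚ_[p])‖ := by
    rw [mul_assoc, norm_mul]
    calc ‖(v : ℚ_[p])‖ * ‖(a n : ℚ_[p]) * (ξ - r)‖ ≤ 1 * ‖ξ - r‖ := by gcongr
      _ = _ := one_mul _
  -- exponential bookkeeping
  have hHrpow : H ^ (-(τ' / (τ - h))) = exp (-(τ' * L)) := by
    rw [rpow_def_of_pos hHpos, hL]; congr 1; field_simp
  have hClower : exp (-(τ' * (n₀ + 1))) * H ^ (-(τ' / (τ - h))) ≤ exp (-(τ' * n)) := by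
    rw [hHrpow, ← exp_add]
    apply exp_le_exp.mpr
    have : 0 ≤ τ' := by linarith
    nlinarith [hnle]
  have hCD : exp (-(τ' * (n₀ + 1))) * H ^ (-(τ' / (τ - h))) ≤ exp (-(h * n)) / H := by
    rw [hHrpow, ← exp_add, le_div_iff₀ hHpos]
    calc exp (-(τ' * (n₀ + 1)) + -(τ' * L)) * H
        = exp (-(τ' * (n₀ + 1)) + -(τ' * L)) * exp (log H) := by rw [exp_log hHpos]
      _ = exp (-(τ' * (n₀ + 1)) + -(τ' * L) + log H) := (exp_add _ _).symm
      _ ≤ exp (-(h * n)) := by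
          apply exp_le_exp.mpr
          rw [hlogL]
          have h0 : 0 ≤ τ' - h := by linarith
          nlinarith [hnle, hL0, mul_nonneg h0 hL0, mul_le_mul_of_nonneg_left hnle hh]
  have hτexp : exp (-(τ * n)) ≤ exp (-(h * n)) / H := by
    rw [le_div_iff₀ hHpos]
    calc exp (-(τ * n)) * H = exp (-(τ * n)) * exp (log H) := by rw [exp_log hHpos]
      _ = exp (-(τ * n) + log H) := (exp_add _ _).symm
      _ ≤ exp (-(h * n)) := by
          apply exp_le_exp.mpr
          rw [hlogL]
          nlinarith [mul_le_mul_of_nonneg_left hLn.le hth.le]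
  -- case analysis on D
  by_cases hD0 : D = 0
  · -- degenerate case: the form is a_n (ξ - r) up to the unit-ish factor v
    have h1 : (v : ℚ_[p]) * ((a n : ℚ_[p]) * (ξ - r)) = (v : ℚ_[p]) * φ := by
      rw [← mul_assoc, hident, hD0]; simp
    have hvne : (v : ℚ_[p]) ≠ 0 := by rw [hv]; exact_mod_cast r.den_nz
    have h2 : (a n : ℚ_[p]) * (ξ - r) = φ := mul_left_cancel₀ hvne h1
    calc exp (-(τ' * (n₀ + 1))) * H ^ (-(τ' / (τ - h))) ≤ exp (-(τ' * n)) := hClower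
      _ ≤ ‖φ‖ := hlower n hn0
      _ = ‖(a n : ℚ_[p]) * (ξ - r)‖ := by rw [h2]
      _ ≤ ‖ξ - ((r : ℚ) : ℚ_[p])‖ := ha_le
  · -- nondegenerate case: ultrametric inequality against the nonzero integer D
    have hDlow : 1 / (D.natAbs : ℝ) ≤ ‖(D : ℚ_[p])‖ := one_div_natAbs_le_norm hD0
    have hDpos : (0 : ℝ) < D.natAbs := by exact_mod_cast Int.natAbs_pos.mpr hD0
    have hDabs : (D.natAbs : ℝ) ≤ exp (h * n) * H := by
      have h1 : D.natAbs ≤ (a n).natAbs * u.natAbs + (b n).natAbs * v := by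
        rw [hD]
        calc (a n * u + b n * ↑v).natAbs ≤ (a n * u).natAbs + (b n * ↑v).natAbs := Int.natAbs_add_le _ _
          _ = (a n).natAbs * u.natAbs + (b n).natAbs * v := by
              rw [Int.natAbs_mul, Int.natAbs_mul, Int.natAbs_natCast]
      have hu' : (u.natAbs : ℝ) ≤ H := le_max_left _ _
      have hv' : (v : ℝ) ≤ H := le_max_right _ _
      have h1' : (D.natAbs : ℝ) ≤ (a n).natAbs * u.natAbs + (b n).natAbs * v := by exact_mod_cast h1
      have hA : (0 : ℝ) ≤ (a n).natAbs := by positivity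
      have hB : (0 : ℝ) ≤ (b n).natAbs := by positivity
      calc (D.natAbs : ℝ) ≤ (a n).natAbs * u.natAbs + (b n).natAbs * v := h1'
        _ ≤ (a n).natAbs * H + (b n).natAbs * H := by gcongr
        _ = ((a n).natAbs + (b n).natAbs) * H := by ring
        _ ≤ exp (h * n) * H := by gcongr; exact hgrowth n hn0
    have hexpD : exp (-(h * n)) / H ≤ ‖(D : ℚ_[p])‖ := by
      have hpos : 0 < exp (h * n) * H := by positivity
      calc exp (-(h * n)) / H = 1 / (exp (h * n) * H) := by rw [exp_neg]; field_simp
        _ ≤ 1 / (D.natAbs : ℝ) := one_div_le_one_div_of_le hDpos hDabs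
        _ ≤ ‖(D : ℚ_[p])‖ := hDlow
    have hvφ : ‖(v : ℚ_[p]) * φ‖ < ‖(D : ℚ_[p])‖ := by
      calc ‖(v : ℚ_[p]) * φ‖ ≤ ‖φ‖ := by
            rw [norm_mul]
            calc ‖(v : ℚ_[p])‖ * ‖φ‖ ≤ 1 * ‖φ‖ := by gcongr
              _ = ‖φ‖ := one_mul _
        _ < exp (-(τ * n)) := hupper n hn0
        _ ≤ exp (-(h * n)) / H := hτexp
        _ ≤ ‖(D : ℚ_[p])‖ := hexpD
    have hultra : ‖(v : ℚ_[p]) * φ - D‖ = ‖(D : ℚ_[p])‖ := by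
      have hne : ‖(v : ℚ_[p]) * φ‖ ≠ ‖(-(D : ℚ_[p]))‖ := by rw [norm_neg]; exact hvφ.ne
      rw [sub_eq_add_neg, Padic.add_eq_max_of_ne hne, norm_neg, max_eq_right hvφ.le]
    calc exp (-(τ' * (n₀ + 1))) * H ^ (-(τ' / (τ - h))) ≤ exp (-(h * n)) / H := hCD
      _ ≤ ‖(D : ℚ_[p])‖ := hexpD
      _ = ‖(v : ℚ_[p]) * (a n : ℚ_[p]) * (ξ - r)‖ := by rw [hident, hultra]
      _ ≤ ‖ξ - ((r : ℚ) : ℚ_[p])‖ := hva_le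

end Summit.KontsevichZagierPeriods.Zeta5Search.PadicIrrationality
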